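import Summits.HubbardSuperconductivity.HubbardSuperconductivity.Theorems.AnisotropyChordTransferFibre3Cs2Fold
import Summits.HubbardSuperconductivity.HubbardSuperconductivity.Theorems.AnisotropyChordTransferFibre3GroundExists
import Summits.HubbardSuperconductivity.HubbardSuperconductivity.Theorems.AnisotropyChordTransferFibre3GradSNormClosed

/-!
# Route `AnisotropyChord` / H0 rotor rung: the (KT-2a″)/(KT-2b″) ROW ASSEMBLIES and the regime clause — brackets ⇒ `LowShellGFormAbs`, `OffPoleTailAbs`, `0 ≤ mHole ∧ side condition` (`L ≥ 3`, `L ≥ 4` for the regime clause)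

Companion of `…Fibre3KT1Assembly` (piece A, stmt-HubbardSuperconductivity-23918): the remaining hypotheses of `gm3_allL`
reduced to numerical brackets of named quantities at the ground profile, by interval arithmetic alone:
* ★ `lowShellGFormAbs_of_brackets`: `lowGForm ≤ G⁺`, `T⁻ ≤ T⁺`, `0 ≤ a`, `G⁺ ≤ a·(Vλ₂/4)·3V²·T⁻` ⇒ `LowShellGFormAbs L Δ a`;
* ★ `offPoleTailAbs_of_brackets` (through `offPoleTailFromPieces_holds` — pair split + `|v| ≤ 3` — and `ground_mirror`):
  `cs2 ≤ C⁺`, `‖C0′‖² ≤ N⁺`, `P⁻ ≤ polePart`, `ℓ⁻ ≤ lowNormPart`, `T⁻ ≤ T⁺ ≤ T⁺⁺ ≤ 2ε₁`, `0 ≤ b`,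
  `(3√C⁺ + 3√N⁺)² − P⁻ − ℓ⁻ ≤ b·(Vλ₂/4)·(2ε₁ − T⁺⁺)·3V²·T⁻` ⇒ `OffPoleTailAbs L Δ b`;
* ★ `regime_of_brackets`: `T⁺ ≤ T⁺⁺ < 2ε₁`, `T⁺⁺ ≤ ε₁(1 − 5/V + 6/V²)/2` (so `m⁻ := ε₁(1−5/V+6/V²)/2 − T⁺⁺ ≥ 0`) and
  `(1 + (3ε₁/(2ε₁ − T⁺⁺))·Δ/((3(1−Δ) + m⁻)/(3 + m⁻)))·(Vλ₂/4)·(a + b/ρ) < c` ⇒ `0 ≤ mHole ∧ facMI·η_eff·(a + b/ρ) < c`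
  (`κ_E` is increasing in `T⁺`, `ĝ₀` is increasing in `m`).
Prover seat `hubbard-h0-rotor-p1` g26 (route lead; per-row assembly); helper for stmt-HubbardSuperconductivity-23918 (`--supports`, helper class).
WHAT THIS IS NOT: nothing here proves superconductivity in the Hubbard model, nor the cruxes — it reduces them to brackets of named
one-loop quantities (produced per `L` by p3's kernel FIN evaluator and ∀ `L ≥ L₀` by the Level-2 rows).  Tree imports only; no sorry, no axioms.
-/

set_option linter.dupNamespace false
set_option autoImplicit false

noncomputable section

open scoped BigOperators

namespace Summit.HubbardSuperconductivity.HubbardSuperconductivity.Theorems.AnisotropyChord.Transfer.Fibre3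

namespace KT2Assembly

variable (L : ℕ) [NeZero L]

/-! ## (KT-2a″) -/

/-- ★ `LowShellGFormAbs` from a bracket on `lowGForm` and a lower bound on `T⁺`. [folklore] -/
theorem lowShellGFormAbs_of_brackets {Δ a : ℝ} (ha : 0 ≤ a)
    (h : ∀ lam2 : ℝ, ∀ f : Tor L → ℝ, IsGroundTwoMagnon L Δ lam2 f →
      ∃ Ghi Tlo : ℝ, lowGForm L Δ f ≤ Ghi ∧ Tlo ≤ Tplus L Δ f ∧ 0 ≤ lam2 ∧
        Ghi ≤ a * ((L : ℝ) ^ 2 * lam2 / 4) * (3 * ((L : ℝ) ^ 2) ^ 2 * Tlo)) :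
    LowShellGFormAbs L Δ a := by
  intro lam2 f hf
  obtain ⟨Ghi, Tlo, hG, hT, hl0, hineq⟩ := h lam2 f hf
  unfold etaEff Uunit
  have hη : 0 ≤ (L : ℝ) ^ 2 * lam2 / 4 := by positivity
  have hmono : a * ((L : ℝ) ^ 2 * lam2 / 4) * (3 * ((L : ℝ) ^ 2) ^ 2 * Tlo)
      ≤ a * ((L : ℝ) ^ 2 * lam2 / 4) * (3 * ((L : ℝ) ^ 2) ^ 2 * Tplus L Δ f) := by
    apply mul_le_mul_of_nonneg_left _ (by positivity)
    exact mul_le_mul_of_nonneg_left hT (by positivity)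
  linarith

/-! ## (KT-2b″) -/

/-- ★ `OffPoleTailAbs` from brackets on `cs2`, `‖C0′‖²`, `polePart`, `lowNormPart`, `T⁺`. [folklore] -/
theorem offPoleTailAbs_of_brackets (hL : 3 ≤ L) {Δ b : ℝ} (hΔ1 : Δ < 1) (hb : 0 ≤ b)
    (h : ∀ lam2 : ℝ, ∀ f : Tor L → ℝ, IsGroundTwoMagnon L Δ lam2 f →
      ∃ Chi Nhi Plo Llo Tlo Thi : ℝ,
        cs2 L f ≤ Chi ∧ nC0p L Δ f ≤ Nhi ∧ Plo ≤ polePart L Δ f ∧ Llo ≤ lowNormPart L Δ f ∧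
        Tlo ≤ Tplus L Δ f ∧ Tplus L Δ f ≤ Thi ∧ Thi ≤ 2 * eps1 L ∧ 0 ≤ Tlo ∧
        (3 * Real.sqrt Chi + 3 * Real.sqrt Nhi) ^ 2 - Plo - Llo
          ≤ b * ((L : ℝ) ^ 2 * lam2 / 4) * (2 * eps1 L - Thi) * (3 * ((L : ℝ) ^ 2) ^ 2 * Tlo)) :
    OffPoleTailAbs L Δ b := by
  intro lam2 f hf
  obtain ⟨Chi, Nhi, Plo, Llo, Tlo, Thi, hC, hN, hP, hLo, hTlo, hThi, hT2, hTlo0, hineq⟩ := h lam2 f hf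
  have hL2 : 2 ≤ L := by omega
  have hmirror : ∀ r : Tor L, f (-r.1, r.2) = f r := ground_mirror L hL2 hf
  have hpieces := offPoleTailFromPieces_holds L hL2 Δ lam2 f hf hmirror
  have hl0 : 0 < lam2 := lam2_pos L hL hΔ1 hf.1
  unfold etaEff Uunit
  -- monotonicity of the square of the square roots
  have hs1 : Real.sqrt (cs2 L f) ≤ Real.sqrt Chi := Real.sqrt_le_sqrt hC
  have hs2 : Real.sqrt (nC0p L Δ f) ≤ Real.sqrt Nhi := Real.sqrt_le_sqrt hN
  have hsq : (3 * Real.sqrt (cs2 L f) + 3 * Real.sqrt (nC0p L Δ f)) ^ 2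
      ≤ (3 * Real.sqrt Chi + 3 * Real.sqrt Nhi) ^ 2 := by
    apply pow_le_pow_left₀ (by positivity)
    linarith
  -- monotonicity of the right-hand side in `T⁺`
  have hR : b * ((L : ℝ) ^ 2 * lam2 / 4) * (2 * eps1 L - Thi) * (3 * ((L : ℝ) ^ 2) ^ 2 * Tlo)
      ≤ b * ((L : ℝ) ^ 2 * lam2 / 4) * (2 * eps1 L - Tplus L Δ f) * (3 * ((L : ℝ) ^ 2) ^ 2 * Tplus L Δ f) := by
    have h1 : (2 * eps1 L - Thi) * (3 * ((L : ℝ) ^ 2) ^ 2 * Tlo)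
        ≤ (2 * eps1 L - Tplus L Δ f) * (3 * ((L : ℝ) ^ 2) ^ 2 * Tplus L Δ f) :=
      mul_le_mul (by linarith) (mul_le_mul_of_nonneg_left hTlo (by positivity)) (by positivity) (by linarith)
    have := mul_le_mul_of_nonneg_left h1 (show 0 ≤ b * ((L : ℝ) ^ 2 * lam2 / 4) by positivity)
    linarith [this]
  linarith

/-! ## The regime clause `0 ≤ mHole ∧ facMI·η_eff·(a + b/ρ) < c` -/

/-- ★ the regime clause from an upper bound `T⁺ ≤ T⁺⁺` and one explicit inequality (`κ_E ↑` in `T⁺`, `ĝ₀ ↑` in `m`). [folklore] -/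
theorem regime_of_brackets (hL : 4 ≤ L) {Δ a b c ρ : ℝ} (hΔ0 : 0 ≤ Δ) (hΔ1 : Δ < 1) (hab : 0 ≤ a + b / ρ)
    (h : ∀ lam2 : ℝ, ∀ f : Tor L → ℝ, IsGroundTwoMagnon L Δ lam2 f →
      ∃ Thi : ℝ, Tplus L Δ f ≤ Thi ∧ Thi ≤ eps1 L * (1 - 5 / (L : ℝ) ^ 2 + 6 / ((L : ℝ) ^ 2) ^ 2) / 2 ∧
        Thi < 2 * eps1 L ∧
        (1 + (3 * eps1 L / (2 * eps1 L - Thi)) * Δ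
            / ((3 * (1 - Δ) + (eps1 L * (1 - 5 / (L : ℝ) ^ 2 + 6 / ((L : ℝ) ^ 2) ^ 2) / 2 - Thi))
              / (3 + (eps1 L * (1 - 5 / (L : ℝ) ^ 2 + 6 / ((L : ℝ) ^ 2) ^ 2) / 2 - Thi))))
          * ((L : ℝ) ^ 2 * lam2 / 4) * (a + b / ρ) < c) :
    ∀ lam2 : ℝ, ∀ f : Tor L → ℝ, IsGroundTwoMagnon L Δ lam2 f →
      0 ≤ mHole L Δ f ∧ facMI L Δ f * etaEff L lam2 * (a + b / ρ) < c := by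
  intro lam2 f hf
  obtain ⟨Thi, hT, hThi, hT2, hineq⟩ := h lam2 f hf
  have hL2 : 2 ≤ L := by omega
  have hε : 0 < eps1 L := eps1_pos L hL
  have hT0 : 0 ≤ Tplus L Δ f := Tplus_nonneg L hL2 hΔ1.le hf
  have hl0 : 0 < lam2 := lam2_pos L (by omega) hΔ1 hf.1
  set T := Tplus L Δ f with hTdef
  set E := eps1 L * (1 - 5 / (L : ℝ) ^ 2 + 6 / ((L : ℝ) ^ 2) ^ 2) / 2 with hE
  have hm : mHole L Δ f = E - T := by unfold mHole; rw [hE]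
  have hm0 : 0 ≤ mHole L Δ f := by rw [hm]; linarith
  refine ⟨hm0, ?_⟩
  -- `κ_E ≤ κ_E(T⁺⁺)` and `ĝ₀ ≥ ĝ₀(m⁻)`
  set mlo := E - Thi with hmlo
  have hmlo0 : 0 ≤ mlo := by rw [hmlo]; linarith
  have hmle : mlo ≤ mHole L Δ f := by rw [hm, hmlo]; linarith
  have hκ : kappaE L Δ f ≤ 3 * eps1 L / (2 * eps1 L - Thi) := by
    unfold kappaE
    apply div_le_div_of_nonneg_left (by positivity) (by linarith) (by linarith)
  have hκ0 : 0 ≤ kappaE L Δ f := by unfold kappaE; apply div_nonneg (by positivity) (by linarith)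
  have hg_lo : (3 * (1 - Δ) + mlo) / (3 + mlo) ≤ g0hat L Δ f := by
    unfold g0hat
    rw [div_le_div_iff₀ (by positivity) (by linarith)]
    nlinarith
  have hg_lo_pos : 0 < (3 * (1 - Δ) + mlo) / (3 + mlo) := by
    apply div_pos _ (by positivity); nlinarith
  have hg0 : 0 < g0hat L Δ f := lt_of_lt_of_le hg_lo_pos hg_lo
  have hfac : facMI L Δ f ≤ 1 + (3 * eps1 L / (2 * eps1 L - Thi)) * Δ / ((3 * (1 - Δ) + mlo) / (3 + mlo)) := by
    unfold facMI
    have h1 : kappaE L Δ f * Δ / g0hat L Δ f ≤ kappaE L Δ f * Δ / ((3 * (1 - Δ) + mlo) / (3 + mlo)) :=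
      div_le_div_of_nonneg_left (by positivity) hg_lo_pos hg_lo
    have h2 : kappaE L Δ f * Δ / ((3 * (1 - Δ) + mlo) / (3 + mlo))
        ≤ (3 * eps1 L / (2 * eps1 L - Thi)) * Δ / ((3 * (1 - Δ) + mlo) / (3 + mlo)) := by
      apply div_le_div_of_nonneg_right _ hg_lo_pos.le
      exact mul_le_mul_of_nonneg_right hκ hΔ0
    linarith
  have hfac0 : 0 ≤ facMI L Δ f := by
    unfold facMI
    have : 0 ≤ kappaE L Δ f * Δ / g0hat L Δ f := by positivity
    linarith
  unfold etaEff
  have hη : 0 ≤ (L : ℝ) ^ 2 * lam2 / 4 := by positivity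
  calc facMI L Δ f * ((L : ℝ) ^ 2 * lam2 / 4) * (a + b / ρ)
      ≤ (1 + (3 * eps1 L / (2 * eps1 L - Thi)) * Δ / ((3 * (1 - Δ) + mlo) / (3 + mlo)))
          * ((L : ℝ) ^ 2 * lam2 / 4) * (a + b / ρ) := by
        apply mul_le_mul_of_nonneg_right _ hab
        exact mul_le_mul_of_nonneg_right hfac hη
    _ < c := by rw [hmlo, hE]; exact hineq

end KT2Assembly

end Summit.HubbardSuperconductivity.HubbardSuperconductivity.Theorems.AnisotropyChord.Transfer.Fibre3

end
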